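import Literature.Combinatorics.SimpleGraph.PendantPathRigidification
import HarnessLib

/-!
# Pendant-path rigidification, II: every equitable colouring of `rigidify G` is injective

Continuation of `PendantPathRigidification.lean`. For an equitable colouring `c` of
`rigidify G` (`IsEquitable`, `ColourRefinement.lean`) we prove in turn:

1. `colour_inl_ne_inr` — an original vertex and a path vertex never share a colour (degrees
   `≥ 3` versus `≤ 2`);
2. `inl_eq_of_colour_eq` — originals with the same colour coincide (they have `hairs n i`
   path-neighbours, and the path vertices form a union of colour classes);
3. `pos_eq_of_colour_eq` — path vertices with the same colour have the same position (strong
   induction on the position: a neighbour one step closer to the free end is matched by a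
   neighbour of the same colour);
4. `eq_of_colour_eq_inr` — path vertices with the same colour coincide (induction on the
   distance to the original vertex, starting from the tops, whose original neighbour has a
   private colour);

so `c` is injective (`IsEquitable.injective_rigidify`) and `rigidify G` is CR-discrete for
EVERY `G` (`isCRDiscrete_rigidify`). Folklore; no printed source.
-/

namespace Literature.Combinatorics.SimpleGraph

open _root_.SimpleGraph Finset PathVert

variable {n : ℕ} {G : _root_.SimpleGraph (Fin n)} {κ : Type*} {c : RVert n → κ}

/-- **Originals and path vertices have different colours** (an original has at least
`hairs n i ≥ 3` neighbours, a path vertex at most `2`). [folklore] -/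
theorem colour_inl_ne_inr (hc : IsEquitable (rigidify G) c) (i : Fin n) (p : PathVert n) :
    c (Sum.inl i) ≠ c (Sum.inr p) := by
  intro h
  have h1 := hc.card_adj_eq h
  have h2 := hairs_le_card_adj_inl (G := G) i
  have h3 := card_adj_inr_le (G := G) p
  have h4 := three_le_hairs i
  have h5 : (if p.pos = 0 then 1 else 2) ≤ 2 := by split_ifs <;> omega
  omega

/-- A vertex with the colour of a path vertex is a path vertex. [folklore] -/
theorem exists_eq_inr_of_colour_eq (hc : IsEquitable (rigidify G) c) {p : PathVert n} {b : RVert n}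
    (h : c b = c (Sum.inr p)) : ∃ q : PathVert n, b = Sum.inr q := by
  cases b with
  | inl i => exact absurd h (colour_inl_ne_inr hc i p)
  | inr q => exact ⟨q, rfl⟩

/-- The path vertices form a union of colour classes. [folklore] -/
theorem saturated_range_inr (hc : IsEquitable (rigidify G) c) (a b : RVert n) (hab : c a = c b) :
    a ∈ Set.range (Sum.inr : PathVert n → RVert n) ↔ b ∈ Set.range (Sum.inr : PathVert n → RVert n) := by
  cases a with
  | inl i =>
    cases b with
    | inl i' => simp
    | inr q => exact absurd hab (colour_inl_ne_inr hc i q)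
  | inr p =>
    cases b with
    | inl i' => exact absurd hab.symm (colour_inl_ne_inr hc i' p)
    | inr q => simp

/-- Original `i` has exactly `hairs n i` path-neighbours (the tops of its paths). [folklore] -/
theorem card_adj_inl_range_inr (i : Fin n) :
    Nat.card {w : RVert n // (rigidify G).Adj (Sum.inl i) w ∧ w ∈ Set.range (Sum.inr : PathVert n → RVert n)} =
      hairs n i := by
  let f : Fin (hairs n i) →
      {w : RVert n // (rigidify G).Adj (Sum.inl i) w ∧ w ∈ Set.range (Sum.inr : PathVert n → RVert n)} :=
    fun ℓ => ⟨Sum.inr (PathVert.mk i ℓ ℓ ℓ.2 le_rfl), ⟨rfl, rfl⟩, ⟨_, rfl⟩⟩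
  have hf : Function.Bijective f := by
    constructor
    · intro a b h
      simp only [f, Subtype.mk.injEq, Sum.inr.injEq, PathVert.ext_iff', vtx_mk, num_mk, pos_mk] at h
      exact Fin.ext h.2.1
    · rintro ⟨w, hadj, ⟨p, rfl⟩⟩
      rw [rigidify_adj_inl_inr] at hadj
      refine ⟨⟨p.num, hadj.1 ▸ p.num_lt⟩, ?_⟩
      exact Subtype.ext (congrArg Sum.inr ((PathVert.ext_iff' _ _).2 ⟨hadj.1.symm, rfl, hadj.2.symm⟩))
  rw [← Nat.card_eq_of_bijective f hf, Nat.card_eq_fintype_card, Fintype.card_fin]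

/-- **Originals with the same colour coincide** (`hairs` is injective). [folklore] -/
theorem inl_eq_of_colour_eq (hc : IsEquitable (rigidify G) c) {i i' : Fin n}
    (h : c (Sum.inl i) = c (Sum.inl i')) : i = i' := by
  have := hc.card_adj_mem_eq (saturated_range_inr hc) h
  rw [card_adj_inl_range_inr, card_adj_inl_range_inr] at this
  exact hairs_injective n this

/-- A path vertex and one of the same colour have the same number of neighbours; at a positive
position there are at least two. [folklore] -/
theorem pos_pos_of_colour_eq (hc : IsEquitable (rigidify G) c) {p q : PathVert n}
    (h : c (Sum.inr p) = c (Sum.inr q)) (hp : 0 < p.pos) : 0 < q.pos := by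
  by_contra hq
  have hq0 : q.pos = 0 := by omega
  have h1 := hc.card_adj_eq h
  have h2 := two_le_card_adj_inr (G := G) hp
  have h3 := card_adj_inr_pos_zero (G := G) hq0
  omega

/-- **Same colour, same position** (strong induction on the position). [folklore] -/
theorem pos_eq_of_colour_eq (hc : IsEquitable (rigidify G) c) :
    ∀ (d : ℕ) (p q : PathVert n), c (Sum.inr p) = c (Sum.inr q) → p.pos = d → q.pos = d := by
  intro d
  induction d using Nat.strong_induction_on with
  | _ d ih =>
    intro p q h hpd
    rcases Nat.eq_zero_or_pos d with rfl | hd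
    · -- position 0: one neighbour only
      by_contra hq
      have := pos_pos_of_colour_eq hc h.symm (by omega)
      omega
    · -- the lower neighbour of `p`, at position `d - 1`
      have hp : 0 < p.pos := by omega
      let a : PathVert n := PathVert.mk p.vtx p.num (p.pos - 1) p.num_lt (by have := p.pos_le; omega)
      have ha : (rigidify G).Adj (Sum.inr p) (Sum.inr a) := ⟨rfl, rfl, Or.inr (Nat.sub_add_cancel hp)⟩
      obtain ⟨b, hb, hcb⟩ := hc.exists_adj_of_adj h ha
      obtain ⟨b', rfl⟩ := exists_eq_inr_of_colour_eq hc hcb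
      have hb'pos : b'.pos = d - 1 := ih (d - 1) (by omega) a b' hcb.symm (by simp [a]; omega)
      rw [rigidify_adj_inr_inr] at hb
      rcases hb.2.2 with hcase | hcase
      · -- `b'` is ABOVE `q`: then `q` sits at `d - 2`; its own lower neighbour is at `d - 3`,
        -- and `p` has no neighbour at that position
        exfalso
        have hqpos : 0 < q.pos := pos_pos_of_colour_eq hc h hp
        let e : PathVert n := PathVert.mk q.vtx q.num (q.pos - 1) q.num_lt (by have := q.pos_le; omega)
        have he : (rigidify G).Adj (Sum.inr q) (Sum.inr e) := ⟨rfl, rfl, Or.inr (Nat.sub_add_cancel hqpos)⟩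
        obtain ⟨f, hf, hcf⟩ := hc.exists_adj_of_adj h.symm he
        obtain ⟨f', rfl⟩ := exists_eq_inr_of_colour_eq hc hcf
        have hf'pos : f'.pos = d - 3 := ih (d - 3) (by omega) e f' hcf.symm (by simp [e]; omega)
        rw [rigidify_adj_inr_inr] at hf
        omega
      · omega

/-- **Same colour, same path vertex** (induction on the distance `num - pos` to the original
vertex: the top's original neighbour has a private colour). [folklore] -/
theorem eq_of_colour_eq_inr (hc : IsEquitable (rigidify G) c) :
    ∀ (k : ℕ) (p q : PathVert n), c (Sum.inr p) = c (Sum.inr q) → p.num - p.pos = k → p = q := by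
  intro k
  induction k with
  | zero =>
    intro p q h hk
    have hpos := pos_eq_of_colour_eq hc p.pos p q h rfl
    have htop : p.pos = p.num := le_antisymm p.pos_le (Nat.sub_eq_zero_iff_le.1 hk)
    -- `p` is joined to its original vertex, which has a private colour
    have ha : (rigidify G).Adj (Sum.inr p) (Sum.inl p.vtx) := ⟨rfl, htop⟩
    obtain ⟨b, hb, hcb⟩ := hc.exists_adj_of_adj h ha
    cases b with
    | inr b' => exact absurd hcb.symm (colour_inl_ne_inr hc p.vtx b')
    | inl i =>
      have hi : i = p.vtx := inl_eq_of_colour_eq hc hcb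
      subst hi
      rw [rigidify_adj_inr_inl] at hb
      rw [PathVert.ext_iff']
      refine ⟨hb.1.symm, ?_, hpos.symm⟩
      rw [← htop, ← hb.2, hpos]
  | succ k ih =>
    intro p q h hk
    have hpos := pos_eq_of_colour_eq hc p.pos p q h rfl
    have hlt : p.pos < p.num := by omega
    let u : PathVert n := PathVert.mk p.vtx p.num (p.pos + 1) p.num_lt hlt
    have hu : (rigidify G).Adj (Sum.inr p) (Sum.inr u) := ⟨rfl, rfl, Or.inl rfl⟩
    obtain ⟨b, hb, hcb⟩ := hc.exists_adj_of_adj h hu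
    obtain ⟨b', rfl⟩ := exists_eq_inr_of_colour_eq hc hcb
    have hub : u = b' := ih u b' hcb.symm (by simp [u]; omega)
    subst hub
    rw [rigidify_adj_inr_inr] at hb
    simp only [u, vtx_mk, num_mk, pos_mk] at hb
    rw [PathVert.ext_iff']
    exact ⟨hb.1.symm, hb.2.1.symm, hpos.symm⟩

/-- **Every equitable colouring of `rigidify G` is injective.** [folklore] -/
theorem IsEquitable.injective_rigidify (hc : IsEquitable (rigidify G) c) : Function.Injective c := by
  intro a b hab
  cases a with
  | inl i =>
    cases b with
    | inl i' => rw [inl_eq_of_colour_eq hc hab]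
    | inr q => exact absurd hab (colour_inl_ne_inr hc i q)
  | inr p =>
    cases b with
    | inl i' => exact absurd hab.symm (colour_inl_ne_inr hc i' p)
    | inr q => rw [eq_of_colour_eq_inr hc (p.num - p.pos) p q hab rfl]

/-- **The rigidified graph is colour-refinement discrete**, for every graph `G`. [folklore] -/
theorem isCRDiscrete_rigidify (G : _root_.SimpleGraph (Fin n)) : IsCRDiscrete (rigidify G) :=
  isCRDiscrete_iff_forall_isEquitable_injective.2 fun _ hc => hc.injective_rigidify

end Literature.Combinatorics.SimpleGraph
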